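import Literature.NumberTheory.GelbartRogawski1991.LocalDoubledTwistedSectionEigenlaw
import Literature.NumberTheory.GelbartRogawski1991.LocalSchrodingerWeylFourierTwin
import Literature.NumberTheory.GelbartRogawski1991.LocalDoubledWeylElementCayleyMover
import HarnessLib

-- buildfix G11b-3 recipe (LEDGER B13-1/B13-3), as in the GelbartRogawski1991 siblings: elaborate sequentially.
set_option Elab.async false

/-!
# (BR-W) THE WEYL WORD of the soft road's twisted section: at the doubling's Weyl element `w_Δ`,
# `s′(w_Δ) = γ · Γ⁻¹ ∘ 𝓕 ∘ m(B′) ∘ Γ` for any implementer `Γ` of a mover `E″` with `E″ ι(w_Δ) E″⁻¹ = J_𝕋⁻¹ m(B′)`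

[Weil1964] n° 13 (16) p. 160 (the Weyl element acts as the Fourier transform); [MoeglinVignerasWaldspurger1987] Chap. 2 II.1 (A), II.6
(implementers unique up to scalars; Weyl element ∕ Levi factors in the Schrödinger model); [Kudla1994] §3 Thm. 3.1 (the splitting of the doubled
unitary group).  Topic `NumberTheory/GelbartRogawski1991`; namespace `Literature.NumberTheory.GelbartRogawski1991.UnitaryDualPair.LocalSplitting`
(sibling of ★ `LocalDoubledTwistedSectionEigenlaw` §4 — SAME CM binder telescope at `ι := kronLoc … 2 …` — and of ★ `LocalSchrodingerWeylFourierTwin`).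
KERNEL ONLY: theorems; no definition, no instance, no notation, no named fact, no `sorry`.

THE STATEMENT.  `L` CM (`c̄`, `δ = imagUnit L`), `v` a finite place of `L⁺`, Haar `μ` on `L⁺_v`, a real symmetric non-degenerate `T ∈ M_{1+1}(L⁺)`, a splitting
Hecke character `χ`, the standard doubled line `G₁ = U(⟨1⟩ ⊕ ⟨−1⟩)(L⁺_v) = localPi L c̄ (1+1) JD₁ v` and its Weyl element
`w₁ := weylDelta L⁺ L c̄ v 1 hJD₁` (adapted matrix `[[0, 1], [1, 0]]`).  The soft road's TWISTED SECTION is `s′(h) = μ_v(det h)⁻¹ • ω^𝔻(s^𝔻(ι h))`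
(`ι = kronLoc … 2`, `s^𝔻 = (localSplittingDatumCM L v μ 2 hTs hTd rfl χ hχ).localSplitting`, `ω^𝔻 = MpPsi.toRep` of the Schrödinger model `ρ_𝕋` of
`gramD L⁺ 2 T ⊗ L⁺_v` — the letters of ★ `apply_zero_toRep_twistedSection_kronLoc_eq_modularCharacter_mul` and of the (OPW) junction
★ `Theorems/F0LD2ZVanOfOperatorWords`).  For a mover `E″ ∈ Sp(𝕎^𝔻_v)`, an implementer `Γ` of `E″` on `𝒮(L⁺_v^{2+2})`, and `B′ ∈ GL_{2+2}(L⁺_v)` with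
`hW : E″ · ι_D(w_Δ²) · E″⁻¹ = J_𝕋⁻¹ · m(B′)` (`w_Δ² = weylDelta … 2`, the IMAGE of `w₁` under `ι` by ★ `kronLoc_weylDelta`; `hW` is DISCHARGED for the Cayley
mover by ★ `LocalDoubledWeylElementCayleyMover.exists_mover_conj_iotaD_weylDelta`):

* **`twistedSection_kronLoc_weylDelta_apply_eq_smul_conj_fourierOpPi_leviOpPi`** — `∃ γ : ℂ, ∀ Ψ, s′(w₁) Ψ = γ • Γ⁻¹ (𝓕 (leviOpPi (glEquiv B′) (Γ Ψ)))`
  (`𝓕 = fourierOpPi μ ψ_v m`, any conductor exponent `m`).  Proof: `ω^𝔻(s^𝔻 g) = β(g)⁻¹ • r(ι g)` (★ `LocalSplittingDatum.localOmega_apply`), ★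
  `kronLoc_weylDelta`, and the section form of the Weyl ∕ Fourier operator twin ★ `leraySection_deltaLagrangian_apply_eq_smul_conj_fourierOpPi_leviOpPi`;
  the three scalars `μ_v(det w₁)⁻¹`, `β⁻¹`, `γ₀` are folded into `γ`.
* **`exists_mover_weylWord`** — the mover-instantiated corollary: `∃ E″ B′, ℓ_Δ.map (toLin E″) = ℓ_Y ∧ ∀ Γ, Implements ρ_𝕋 E″ Γ → ∃ γ, ∀ Ψ, s′(w₁) Ψ = γ • …`
  (★ `exists_mover_conj_iotaD_weylDelta`), so that ONE pair `(E″, Γ)` serves both operator words of the (OPW) junction.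

Cell hodgecm-mathlib, line LD2 (soft road (π3) for the organ `LineThetaTypesComplementary₁` of crux hLiu418 = `stmt-HodgeConjecture-24832`), plate (BR-W)
of LD2-plan (g3) DEALS #24 (1); consumer: A-p19 (g31)'s `operatorWords_holds`.  HONEST LABEL: nothing of print is asserted; HC_CM is proved only modulo
the 7 printed citations (2 remaining: hLiu418 = stmt-HodgeConjecture-24832, h413 = stmt-HodgeConjecture-24833) until rung 0 closes; count-neutral.

## References
* [Weil1964] A. Weil, *Sur certains groupes d'opérateurs unitaires*, Acta Math. 111 (1964), n° 13 (16), p. 160.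
* [MoeglinVignerasWaldspurger1987] C. Mœglin, M.-F. Vignéras, J.-L. Waldspurger, LNM 1291 (1987), Chap. 2 II.1 (A), II.6.
* [Kudla1994] S. S. Kudla, *Splitting metaplectic covers of dual reductive pairs*, Israel J. Math. 87 (1994), §3 Thm. 3.1.
-/

set_option autoImplicit false

noncomputable section

open scoped Matrix Kronecker
open NumberField IsDedekindDomain MeasureTheory MeasureTheory.Measure
open Literature.NumberTheory Literature.NumberTheory.Automorphic Literature.NumberTheory.Automorphic.UnitaryGroup
open Literature.RepresentationTheory Literature.RepresentationTheory.HeisenbergGroup Literature.RepresentationTheory.TwistedCoinv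
open Literature.RepresentationTheory.HeisenbergGroup.SymplecticMatrix
open Literature.NumberTheory.GelbartRogawski1991 Literature.NumberTheory.GelbartRogawski1991.UnitaryDualPair
open Literature.NumberTheory.GelbartRogawski1991.UnitaryDualPair.WeilCoinv
open Literature.NumberTheory.Weil1964
open Literature.NumberTheory.GaloisRepresentations Literature.NumberTheory.GaloisRepresentations.IsNonarchimedeanLocalField
open Literature.RepresentationTheory.HarrisKudlaSweet1996
open Literature.RepresentationTheory.MoeglinVignerasWaldspurger1987

namespace Literature.NumberTheory.GelbartRogawski1991.UnitaryDualPair.LocalSplitting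

variable (L : Type) [Field L] [NumberField L] [IsCMField L] (v : HeightOneSpectrum (𝓞 (maximalRealSubfield L)))
  [MeasurableSpace (v.adicCompletion (maximalRealSubfield L))] [BorelSpace (v.adicCompletion (maximalRealSubfield L))]
  (μ : Measure (v.adicCompletion (maximalRealSubfield L))) [μ.IsAddHaarMeasure]
  {T : Matrix (Fin (1 + 1)) (Fin (1 + 1)) (maximalRealSubfield L)} (hTs : T.IsSymm) (hTd : IsUnit T.det)
  (χ : HeckeCharacter L) (hχ : IsSplittingChar L 1 χ)
  {JD₁ : Matrix (Fin (1 + 1)) (Fin (1 + 1)) L}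
  (hJD₁ : JD₁ = (gramD (maximalRealSubfield L) 1 1).map (algebraMap (maximalRealSubfield L) L))
  (hTv : IsUnit (localGram (maximalRealSubfield L) (2 + 2) (gramD (maximalRealSubfield L) 2 T) v).det)

set_option synthInstance.maxHeartbeats 400000 in
set_option maxHeartbeats 4000000 in -- the doubled CM datum's telescope (as the (OPW) junction)
/-- **(BR-W) THE WEYL WORD.**  For a mover `E″ ∈ Sp(𝕎^𝔻_v)`, an implementer `Γ` of `E″`, and `B′` with `E″ · ι_D(w_Δ²) · E″⁻¹ = J_𝕋⁻¹ · m(B′)`: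
the twisted section of the standard doubled line at its Weyl element `w₁` is `γ • Γ⁻¹ ∘ 𝓕 ∘ leviOpPi B′ ∘ Γ` for some `γ ∈ ℂ` (the twist
`μ_v(det w₁)⁻¹`, Kudla's `β(ι w₁)⁻¹` and the Weil-index unit of the twin folded into `γ`).
[cite: Weil1964, n° 13 (16), p. 160] [cite: MoeglinVignerasWaldspurger1987, Chap. 2 II.1 (A), II.6] [cite: Kudla1994, §3 Thm. 3.1] -/
theorem twistedSection_kronLoc_weylDelta_apply_eq_smul_conj_fourierOpPi_leviOpPi
    (E'' : LocalSp (maximalRealSubfield L) (2 + 2) (gramD (maximalRealSubfield L) 2 T) v)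
    (Γ : SchwartzBruhat (Fin (2 + 2) → v.adicCompletion (maximalRealSubfield L)) ≃ₗ[ℂ]
      SchwartzBruhat (Fin (2 + 2) → v.adicCompletion (maximalRealSubfield L)))
    (hΓ : Implements (localSchrodinger (maximalRealSubfield L) (2 + 2) (gramD (maximalRealSubfield L) 2 T) v) (ofSymplectic _ E'') Γ)
    (B' : GL (Fin (2 + 2)) (v.adicCompletion (maximalRealSubfield L)))
    (hW : E'' * iotaD (maximalRealSubfield L) L (IsCMField.complexConj L) (complexConj_imagUnit L) (imagUnit_ne_zero L)
        (imagUnit_mul_self L) v 2 hTs rfl (weylDelta (maximalRealSubfield L) L (IsCMField.complexConj L) v 2 (T₀ := T) rfl) * E''⁻¹ =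
      (transportSp (localGram (maximalRealSubfield L) (2 + 2) (gramD (maximalRealSubfield L) 2 T) v) hTv (SymplecticGroup.symJ _ _))⁻¹ *
        transportSp (localGram (maximalRealSubfield L) (2 + 2) (gramD (maximalRealSubfield L) 2 T) v) hTv (levi B'))
    {m : ℤ} (hm : (adeleAddCharAt (maximalRealSubfield L) v).HasConductorExp m) :
    ∃ γ : ℂ, ∀ Ψ : SchwartzBruhat (Fin (2 + 2) → v.adicCompletion (maximalRealSubfield L)),
      (((localMu L χ v (Matrix.GeneralLinearGroup.det ((localPiEquiv L (IsCMField.complexConj L) (1 + 1) JD₁ v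
          (weylDelta (maximalRealSubfield L) L (IsCMField.complexConj L) v 1 hJD₁)).1)))⁻¹ : ℂˣ) : ℂ) •
        MpPsi.toRep (localSchrodinger (maximalRealSubfield L) (2 + 2) (gramD (maximalRealSubfield L) 2 T) v)
          ((localSplittingDatumCM L v μ 2 hTs hTd rfl χ hχ).localSplitting
            (kronLoc (maximalRealSubfield L) L (IsCMField.complexConj L) v 2 (T := T) (J := T.map (algebraMap (maximalRealSubfield L) L))
              rfl rfl hJD₁ (weylDelta (maximalRealSubfield L) L (IsCMField.complexConj L) v 1 hJD₁))) Ψ =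
        γ • Γ.symm (fourierOpPi μ (isContinuousNontrivial_adeleAddCharAt (maximalRealSubfield L) v) hm (leviOpPi (glEquiv B') (Γ Ψ))) := by
  set D := localSplittingDatumCM L v μ 2 hTs hTd rfl χ hχ with hD
  -- `ι(w₁) = w_Δ²`
  have hkron : kronLoc (maximalRealSubfield L) L (IsCMField.complexConj L) v 2 (T := T)
      (J := T.map (algebraMap (maximalRealSubfield L) L)) rfl rfl hJD₁
        (weylDelta (maximalRealSubfield L) L (IsCMField.complexConj L) v 1 hJD₁) =
      weylDelta (maximalRealSubfield L) L (IsCMField.complexConj L) v 2 (T₀ := T) rfl :=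
    kronLoc_weylDelta ..
  -- the section form of the Weyl ∕ Fourier operator twin for `r = D.r`, `h = ι_D(w_Δ²)`
  obtain ⟨γ₀, hγ₀⟩ := leraySection_deltaLagrangian_apply_eq_smul_conj_fourierOpPi_leviOpPi (maximalRealSubfield L) (2 + 2)
    (gramD (maximalRealSubfield L) 2 T) v μ hTv D.hU D.r E'' Γ hΓ
    (iotaD (maximalRealSubfield L) L (IsCMField.complexConj L) (complexConj_imagUnit L) (imagUnit_ne_zero L)
      (imagUnit_mul_self L) v 2 hTs rfl (weylDelta (maximalRealSubfield L) L (IsCMField.complexConj L) v 2 (T₀ := T) rfl)) B' hW hm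
  refine ⟨(((localMu L χ v (Matrix.GeneralLinearGroup.det ((localPiEquiv L (IsCMField.complexConj L) (1 + 1) JD₁ v
      (weylDelta (maximalRealSubfield L) L (IsCMField.complexConj L) v 1 hJD₁)).1)))⁻¹ : ℂˣ) : ℂ) *
    ((((D.beta (weylDelta (maximalRealSubfield L) L (IsCMField.complexConj L) v 2 (T₀ := T) rfl))⁻¹ : ℂˣ) : ℂ) * (γ₀ : ℂ)),
    fun Ψ => ?_⟩
  -- `ω^𝔻(s^𝔻 g) Ψ = β(g)⁻¹ • r(ι g) Ψ`
  have hω : MpPsi.toRep (localSchrodinger (maximalRealSubfield L) (2 + 2) (gramD (maximalRealSubfield L) 2 T) v)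
        (D.localSplitting (kronLoc (maximalRealSubfield L) L (IsCMField.complexConj L) v 2 (T := T)
          (J := T.map (algebraMap (maximalRealSubfield L) L)) rfl rfl hJD₁
            (weylDelta (maximalRealSubfield L) L (IsCMField.complexConj L) v 1 hJD₁))) Ψ =
      D.localOmega (weylDelta (maximalRealSubfield L) L (IsCMField.complexConj L) v 2 (T₀ := T) rfl) Ψ := by
    rw [hkron]; rfl
  rw [hω, D.localOmega_apply, hγ₀ Ψ, Units.smul_def, smul_smul, smul_smul, mul_assoc]


include hTd hTv in
set_option synthInstance.maxHeartbeats 400000 in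
set_option maxHeartbeats 4000000 in -- the doubled CM datum's telescope (as the (OPW) junction)
/-- **(BR-W), MOVER-INSTANTIATED** — one pair `(E″, B′)` for BOTH operator words: there are a mover `E″ ∈ Sp(𝕎^𝔻_v)` with `E″ ℓ_Δ = ℓ_Y` (the
hypothesis `hE′`∕`hm₀` of the unipotent word and of the `Δ`-functional) and `B′ ∈ GL_{2+2}(L⁺_v)` such that for EVERY implementer `Γ` of `E″` the
twisted section of the standard doubled line at its Weyl element `w₁` is `γ • Γ⁻¹ ∘ 𝓕 ∘ leviOpPi B′ ∘ Γ` for some `γ ∈ ℂ` (★ `exists_mover_conj_iotaD_weylDelta`: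
the Cayley mover and the quarter turn). [cite: Weil1964, n° 13 (16), p. 160] [cite: MoeglinVignerasWaldspurger1987, Chap. 2 II.1 (A), II.6] [cite: Kudla1994, §3 Thm. 3.1] -/
theorem exists_mover_weylWord {m : ℤ} (hm : (adeleAddCharAt (maximalRealSubfield L) v).HasConductorExp m) :
    ∃ (E'' : LocalSp (maximalRealSubfield L) (2 + 2) (gramD (maximalRealSubfield L) 2 T) v)
      (B' : GL (Fin (2 + 2)) (v.adicCompletion (maximalRealSubfield L))),
      (deltaLagrangian (maximalRealSubfield L) v 2).map (toLin (maximalRealSubfield L) v E'') =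
        lagrangianY (maximalRealSubfield L) (2 + 2) v ∧
      ∀ (Γ : SchwartzBruhat (Fin (2 + 2) → v.adicCompletion (maximalRealSubfield L)) ≃ₗ[ℂ]
          SchwartzBruhat (Fin (2 + 2) → v.adicCompletion (maximalRealSubfield L))),
        Implements (localSchrodinger (maximalRealSubfield L) (2 + 2) (gramD (maximalRealSubfield L) 2 T) v) (ofSymplectic _ E'') Γ →
        ∃ γ : ℂ, ∀ Ψ : SchwartzBruhat (Fin (2 + 2) → v.adicCompletion (maximalRealSubfield L)),
          (((localMu L χ v (Matrix.GeneralLinearGroup.det ((localPiEquiv L (IsCMField.complexConj L) (1 + 1) JD₁ v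
              (weylDelta (maximalRealSubfield L) L (IsCMField.complexConj L) v 1 hJD₁)).1)))⁻¹ : ℂˣ) : ℂ) •
            MpPsi.toRep (localSchrodinger (maximalRealSubfield L) (2 + 2) (gramD (maximalRealSubfield L) 2 T) v)
              ((localSplittingDatumCM L v μ 2 hTs hTd rfl χ hχ).localSplitting
                (kronLoc (maximalRealSubfield L) L (IsCMField.complexConj L) v 2 (T := T) (J := T.map (algebraMap (maximalRealSubfield L) L))
                  rfl rfl hJD₁ (weylDelta (maximalRealSubfield L) L (IsCMField.complexConj L) v 1 hJD₁))) Ψ =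
            γ • Γ.symm (fourierOpPi μ (isContinuousNontrivial_adeleAddCharAt (maximalRealSubfield L) v) hm (leviOpPi (glEquiv B') (Γ Ψ))) := by
  obtain ⟨E'', B', hE'', hW⟩ := exists_mover_conj_iotaD_weylDelta (maximalRealSubfield L) L (IsCMField.complexConj L)
    (complexConj_imagUnit L) (imagUnit_ne_zero L) (imagUnit_mul_self L) v 2 hTs hTd (rfl : (gramD (maximalRealSubfield L) 2 T).map
      (algebraMap (maximalRealSubfield L) L) = _) hTv
  exact ⟨E'', B', hE'', fun Γ hΓ =>
    twistedSection_kronLoc_weylDelta_apply_eq_smul_conj_fourierOpPi_leviOpPi L v μ hTs hTd χ hχ hJD₁ hTv E'' Γ hΓ B' hW hm⟩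

end Literature.NumberTheory.GelbartRogawski1991.UnitaryDualPair.LocalSplitting

end
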